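import Summits.BirchSwinnertonDyer.Rank1Residual.P2.CornerFTwoModelLocalTwo
import Literature.NumberTheory.EllipticCurves.HuShuYin2019.SylvesterThreePart
import HarnessLib

/-!
# Leaf CornerF @ `p = 2` — THE MODEL ATLAS, file 9 (cell `bsd-print-cf2`, D-0131 (2) print tier,
# typer ty2): the CUBE-SUM curves `x³ + y³ = n` at the prime `2` — INERT-GOOD iff `n` is odd

HONEST FRAMING (cell `bsd-print-cf2`, HOME `run/shared/lean/pub/bsd-print-cf2/`, verbatim in every
file): the partition leaf is `CornerF W 2` — `W/ℚ` globally minimal elliptic WITH CM and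
`ord_{s=1} L(E,s) = 1`, at the prime `2` (rung leaf `WAllCornerFTwo`; OPEN AS A CLASS). Nothing
class-wide is closed here. The cube-sum curves `C_n : x³ + y³ = n` (`j = 0`, CM by `ℤ[ζ₃]`, `2` inert in `ℚ(√−3)`;
tree model `HuShuYin2019.cubeSumCurve n = (y² = x³ − 432n²)`) sit inside item
stmt-BirchSwinnertonDyer-20671 `InertJZeroOfFacts`; the rev-5 birth cut of that item is the reduction
type at `2`. THIS FILE decides the cut on `C_n` (`n ∈ ℤ∖{0}`, `8 ∤ n`, e.g. `n` cube-free): a globally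
minimal model of `C_n` is GOOD at `2` iff `n` is ODD (`good_two_iff_of_smul_cubeSumCurve`): for `n` odd
`−432n² = 16·(−27n²)` with `−27n² ≡ 1 (mod 4)` (`C_n ≅ y² + y = x³ − (27n² + 1)/4`; `C_1 = 27a`), for
`n = 2m` the `u = 2` rescaling `y² = x³ − 27m²` has `−27m²` odd or `≡ 20, 52 (mod 64)`, never
`≡ 16 (mod 64)` (file 7 `good_two_iff_of_smul_sextic`). READING for the cell's lanes: the Sylvester
curves `x³ + y³ = p`, `p` an odd prime (K7t leaf `X12.CMAtTwo`; Dasgupta–Voight, Hu–Shu–Yin, Shu–Yin)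
and all odd cube-free `n` are INERT-GOOD; the twice-primes curves `x³ + y³ = 2p, 2p²` (Satgé 1987,
Cai–Shu–Tian 2017, Kezuka–Li 2020) and `36a1 = C_2` with its Shu–Zhai twist family (aside 20597) are
INERT-BAD. Fact-free: NO arithmetic fact, NO definition, NO named fact (D-0026); `beyond-print: NO`.

References: [HuShuYin2019] p. 4 (the model `y² = x³ − 432n²`); [KezukaLi2020] (4.1) (p. 2139:
"`y² = x³ − 27p^{2j}` gives a minimal model of `C_{2p^j}` at `2`"); [SilvermanAEC2009] VII.1 Rem. 1.1,
VII.5 Prop. 5.1(a); `P2/CornerFTwoModelLocalTwo.lean` (file 7).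
-/

noncomputable section

open scoped Classical

open WeierstrassCurve Literature.NumberTheory.EllipticCurves
  Literature.NumberTheory.EllipticCurves.Rank1Residual IsDedekindDomain NumberField Rat.HeightOneSpectrum

set_option autoImplicit false

namespace Summit.BirchSwinnertonDyer.Rank1Residual.P2.CornerFTwo

namespace Atlas

/-! ### The cube-sum curves `x³ + y³ = n` (`y² = x³ − 432n²`, tree `HuShuYin2019.cubeSumCurve`) at `2` -/

/-- An odd integer has square `≡ 1 (mod 8)`. [folklore] -/
theorem sq_emod_eight_of_odd {x : ℤ} (hx : x % 2 = 1) : x ^ 2 % 8 = 1 := by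
  obtain ⟨y, hy⟩ : ∃ y : ℤ, x = 2 * y + 1 := ⟨x / 2, by omega⟩
  obtain ⟨t, ht⟩ := Int.even_mul_succ_self y
  have e : x ^ 2 = 4 * (y * (y + 1)) + 1 := by rw [hy]; ring
  rw [e, ht]
  omega

/-- **Cube sums, odd `n`: GOOD at `2`.** For `n` odd, every `ℚ`-model of the cube-sum curve
`x³ + y³ = n` (`y² = x³ − 432n²`) has good reduction at `2`: `−432n² = 16·(−27n²)` with
`−27n² ≡ 1 (mod 4)`, i.e. `y² = x³ − 432n² ≅ y² + y = x³ − (27n² + 1)/4` (for `n = 1`: `27a1`). So the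
Sylvester curves `x³ + y³ = p` (`p` an odd prime) and `x³ + y³ = n`, `n` odd cube-free, lie in cell
INERT-GOOD. [cite: HuShuYin2019, p. 4 (the model y² = x³ − 432n²)]
[cite: SilvermanAEC2009, VII.5 Prop. 5.1(a)] -/
theorem good_two_of_smul_cubeSumCurve_of_odd {n : ℤ} (hn : n % 2 = 1) {W : WeierstrassCurve ℚ}
    {C : VariableChange ℚ} (hC : C • HuShuYin2019.cubeSumCurve (n : ℚ) = W) : Good W 2 := by
  have h8 := sq_emod_eight_of_odd hn
  have e : HuShuYin2019.cubeSumCurve (n : ℚ) = ⟨0, 0, 0, 0, (((-432 * n ^ 2 : ℤ)) : ℚ)⟩ := by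
    simp only [HuShuYin2019.cubeSumCurve]; push_cast; ring_nf
  rw [← hC, e, Good, hasGoodReductionAtPrime_iff_of_variableChange]
  exact good_two_sextic_of_emod_sixtyFour (by omega)

/-- **Cube sums, even cube-free `n`: BAD at `2`.** For `n = 2m` with `4 ∤ m` (so every even CUBE-FREE
`n`), a globally minimal model of `x³ + y³ = n` does NOT have good reduction at `2`:
`y² = x³ − 432·4m² ≅ y² = x³ − 27m²` (`u = 2`), and `−27m²` is odd (`m` odd) resp. `≡ 20, 52 (mod 64)`
(`m = 2k`, `k` odd) — never `≡ 16 (mod 64)`. So the twice-primes curves `x³ + y³ = 2p, 2p²`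
(Satgé 1987, Cai–Shu–Tian 2017) and `36a1 = (x³ + y³ = 2)` lie in cell INERT-BAD.
[cite: KezukaLi2020, (4.1) (p. 2139: "y² = x³ − 27p^{2j} gives a minimal model of C_{2p^j} at 2")]
[cite: SilvermanAEC2009, VII.1 Remark 1.1 and VII.5 Prop. 5.1(a)] -/
theorem not_good_two_of_smul_cubeSumCurve_of_even {m : ℤ} (hm : ¬ (4 : ℤ) ∣ m) (hm0 : m ≠ 0)
    {W : WeierstrassCurve ℚ} [W.IsElliptic] [W.IsGloballyMinimal] {C : VariableChange ℚ}
    (hC : C • HuShuYin2019.cubeSumCurve ((2 * m : ℤ) : ℚ) = W) : ¬ Good W 2 := by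
  -- `W` is a model of `y² = x³ − 27m²`
  have e : HuShuYin2019.cubeSumCurve ((2 * m : ℤ) : ℚ) =
      (⟨Units.mk0 (2⁻¹ : ℚ) (by norm_num), 0, 0, 0⟩ : VariableChange ℚ) •
        (⟨0, 0, 0, 0, (((-27 * m ^ 2 : ℤ)) : ℚ)⟩ : WeierstrassCurve ℚ) := by
    rw [smul_sextic_sixtyFour]
    simp only [HuShuYin2019.cubeSumCurve]; push_cast; ring_nf
  rw [e, ← mul_smul] at hC
  have hB0 : (-27 * m ^ 2 : ℤ) ≠ 0 := mul_ne_zero (by norm_num) (pow_ne_zero 2 hm0)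
  intro hgood
  rcases (show m % 2 = 1 ∨ ∃ k : ℤ, m = 2 * k ∧ k % 2 = 1 from by
    rcases Int.emod_two_eq_zero_or_one m with h | h
    · exact Or.inr ⟨m / 2, by omega, by omega⟩
    · exact Or.inl h) with hodd | ⟨k, rfl, hk⟩
  · -- `m` odd: `−27m²` odd
    have h8 := sq_emod_eight_of_odd hodd
    have h := (good_two_iff_of_smul_sextic hB0 (by omega) hC).mp hgood
    omega
  · -- `m = 2k`, `k` odd: `−108k² ≡ 20, 52 (mod 64)`
    have h8 := sq_emod_eight_of_odd hk
    have e2 : (-27 * (2 * k) ^ 2 : ℤ) = -108 * k ^ 2 := by ring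
    have h64 : ¬ (64 : ℤ) ∣ (-27 * (2 * k) ^ 2) := by rw [e2]; omega
    have h := (good_two_iff_of_smul_sextic hB0 h64 hC).mp hgood
    rw [e2] at h
    omega

/-- **CUBE SUMS AT `2`, the dichotomy.** For `n ∈ ℤ∖{0}` with `8 ∤ n` (e.g. `n` cube-free) and a
globally minimal model `W` of `x³ + y³ = n`: `W` has good reduction at `2` iff `n` is odd.
[cite: HuShuYin2019, p. 4 (the model y² = x³ − 432n²)] [cite: KezukaLi2020, (4.1) (p. 2139)]
[cite: SilvermanAEC2009, VII.5 Prop. 5.1(a)] -/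
theorem good_two_iff_of_smul_cubeSumCurve {n : ℤ} (hn : n ≠ 0) (h8 : ¬ (8 : ℤ) ∣ n)
    {W : WeierstrassCurve ℚ} [W.IsElliptic] [W.IsGloballyMinimal] {C : VariableChange ℚ}
    (hC : C • HuShuYin2019.cubeSumCurve (n : ℚ) = W) : Good W 2 ↔ n % 2 = 1 := by
  constructor
  · intro hgood
    by_contra hodd
    obtain ⟨m, rfl⟩ : ∃ m : ℤ, n = 2 * m := ⟨n / 2, by omega⟩
    exact not_good_two_of_smul_cubeSumCurve_of_even (m := m) (by omega) (by omega) hC hgood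
  · intro hodd
    exact good_two_of_smul_cubeSumCurve_of_odd hodd hC

end Atlas

end Summit.BirchSwinnertonDyer.Rank1Residual.P2.CornerFTwo

end
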